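import Mathlib
import Literature.AlgebraicGeometry.Resolution.TameQuotientSingularitiesResolution
import Summits.ResolutionOfSingularities.ResolutionOfSingularities.Theorems.FrobeniusLadderFRationalResolutionDiagonalizableQuotientPerfect
import HarnessLib

/-!
# Bergh–Rydh consumes the twisted `μ_p`-chart (crux `FoliationDescent.LogCanQuotLU`, line `birth`)

Stub `stub_hasResolutionOfChart` of the skeleton `Lines/birth.lean` for crux
stmt-ResolutionOfSingularities-17082. Granted the named fact
`BerghRydh2019_diagonalizableQuotientResolution` (Bergh–Rydh 2019, Thm. 5, diagonalizable case,
taken as the hypothesis), a finitely generated domain `C` over a PERFECT field `k` carrying a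
"chart package" — a finite-type REGULAR `k`-algebra `S` graded by a finite abelian group `A`,
together with an ÉTALE `C`-algebra structure on the degree-zero part `S₀ = 𝒮 0` lying over every
prime of `C` — has `Scheme.HasResolution (Spec C)`.

The proof is scheme plumbing: `X := Spec C` is integral (a domain), affine over `Spec k` (hence
separated and quasi-compact) and locally of finite type; the single chart
`φ := Spec S₀ → Spec C` is étale (`HasRingHomProperty.Spec_iff`, `RingHom.etale_algebraMap`),
every point of `Spec C` is in its range (lying over), and it is a `k`-morphism
(`IsScalarTower.algebraMap_eq`). Then
`FRationalResolution.diagonalizableQuotientResolution_of_perfectField` (regular charts over a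
perfect field are smooth charts, then Bergh–Rydh) applies.
-/

set_option linter.dupNamespace false

noncomputable section

open CategoryTheory AlgebraicGeometry Literature.AlgebraicGeometry.Resolution

namespace Summit.ResolutionOfSingularities.ResolutionOfSingularities.Theorems

/-- **Bergh–Rydh consumes the chart** (conditional on the named fact
`BerghRydh2019_diagonalizableQuotientResolution`, taken as the first hypothesis): a finitely
generated domain `C` over a perfect field `k` admitting a finite-type regular `k`-algebra `S`
graded by a finite abelian group, whose degree-zero part `𝒮 0` is an étale `C`-algebra
(compatibly with `k`) lying over every prime of `C`, satisfies `Scheme.HasResolution (Spec C)`.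
[cite: BerghRydh2019, Thm 5 (arXiv:1905.00872, p. 4)] -/
theorem stub_hasResolutionOfChart :
    Literature.AlgebraicGeometry.Resolution.BerghRydh2019_diagonalizableQuotientResolution →
    ∀ (k : Type) [Field k] [PerfectField k] (C : Type) [CommRing C] [IsDomain C] [Algebra k C],
      Algebra.FiniteType k C →
      (∃ (A : Type) (_ : AddCommGroup A) (_ : Finite A) (_ : DecidableEq A) (S : Type)
        (_ : CommRing S) (_ : Algebra k S) (𝒮 : A → Submodule k S) (_ : GradedAlgebra 𝒮),
        Algebra.FiniteType k S ∧ IsRegularRing S ∧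
        ∃ (_ : Algebra C (𝒮 0)) (_ : IsScalarTower k C (𝒮 0)), Algebra.Etale C (𝒮 0) ∧
          ∀ P : Ideal C, P.IsPrime →
            ∃ Q : Ideal (𝒮 0), Q.IsPrime ∧ Q.comap (algebraMap C (𝒮 0)) = P) →
      Literature.AlgebraicGeometry.Resolution.Scheme.HasResolution
        (AlgebraicGeometry.Spec (CommRingCat.of C)) := by
  intro hBR k _ _ C _ _ _ hCft h
  obtain ⟨A, _, _, _, S, _, _, 𝒮, _, hft, hreg, _, _, het, hsurj⟩ := h
  -- the structure morphism `g : X = Spec C ⟶ Spec k`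
  let g : Spec (.of C) ⟶ Spec (.of k) := Spec.map (CommRingCat.ofHom (algebraMap k C))
  haveI : LocallyOfFiniteType g :=
    (HasRingHomProperty.Spec_iff (P := @LocallyOfFiniteType)).mpr
      (RingHom.finiteType_algebraMap.mpr hCft)
  refine FRationalResolution.diagonalizableQuotientResolution_of_perfectField hBR k
    (Spec (.of C)) g fun x => ?_
  -- the chart `φ : Spec S₀ ⟶ Spec C`
  let φ : Spec (.of (𝒮 0)) ⟶ Spec (.of C) :=
    Spec.map (CommRingCat.ofHom (algebraMap C (𝒮 0)))
  have hφ : Etale φ :=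
    (HasRingHomProperty.Spec_iff (P := @Etale)).mpr (RingHom.etale_algebraMap.mpr het)
  -- `x` is in the range of `φ`: lying over
  obtain ⟨Q, hQ, hQx⟩ := hsurj x.asIdeal x.isPrime
  have hx : x ∈ Set.range φ := by
    refine ⟨⟨Q, hQ⟩, ?_⟩
    change PrimeSpectrum.comap (CommRingCat.ofHom (algebraMap C (𝒮 0))).hom ⟨Q, hQ⟩ = x
    ext1
    rw [PrimeSpectrum.comap_asIdeal, CommRingCat.hom_ofHom]
    exact hQx
  -- `φ` is a `k`-morphism
  have hcomp : φ ≫ g = Spec.map (CommRingCat.ofHom (algebraMap k (𝒮 0))) := by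
    change Spec.map (CommRingCat.ofHom (algebraMap C (𝒮 0))) ≫
        Spec.map (CommRingCat.ofHom (algebraMap k C)) = _
    rw [← Spec.map_comp, ← CommRingCat.ofHom_comp, ← IsScalarTower.algebraMap_eq k C (𝒮 0)]
  exact ⟨A, inferInstance, inferInstance, inferInstance, S, inferInstance, inferInstance, 𝒮,
    inferInstance, hft, hreg, φ, hφ, hx, hcomp⟩

end Summit.ResolutionOfSingularities.ResolutionOfSingularities.Theorems

end
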